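import Mathlib.LinearAlgebra.TensorProduct.RightExactness
import Mathlib.LinearAlgebra.Quotient.Basic
import Mathlib.RingTheory.Flat.Basic
import Literature.AlgebraicGeometry.Motives.HodgeStructure
import HarnessLib

/-!
# Mixed `ℚ`-Hodge structures (abstract linear-algebra layer)

A **mixed `ℚ`-Hodge structure** (MHS) on a `ℚ`-vector space `V` consists of a finite increasing
*weight filtration* `W` of `V` by `ℚ`-subspaces and a finite decreasing *Hodge filtration* `F` of
the complexification `V_ℂ = ℂ ⊗[ℚ] V` by `ℂ`-subspaces such that, for every `k`, the filtration
induced by `F` on `ℂ ⊗ Gr^W_k V`, `Gr^W_k V = W_k / W_{k-1}`,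
`F^p Gr^W_k := ((F^p ∩ W_{k,ℂ}) + W_{k-1,ℂ}) / W_{k-1,ℂ}`, is a pure `ℚ`-Hodge structure of
weight `k`, i.e. is `k`-opposed to its complex conjugate (Deligne, *Théorie de Hodge II*,
Déf. 2.3.1; Cattani–El Zein–Griffiths–Lê, *Hodge Theory*, Def. 3.2.15; Carlson, *Extensions of
mixed Hodge structures*, §2(a)). This file extends the pure layer
`Literature/AlgebraicGeometry/Motives/HodgeStructure.lean` (`HodgeStructure V n`, filtration
form, complex conjugation `HodgeStructure.conj = conj ⊗ id` on `ℂ ⊗[ℚ] V`).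

## Main definitions

* `MixedHodgeStructure.grW W k` — the graded piece `Gr^W_k = W k ⧸ (W (k-1) ∩ W k)` of an
  increasing filtration, and `MixedHodgeStructure.grF W F k p`, the filtration induced by `F` on
  `ℂ ⊗[ℚ] Gr^W_k` (comap along `W_{k,ℂ} → V_ℂ`, then map along `W_{k,ℂ} → ℂ ⊗ Gr^W_k`).
* `MixedHodgeStructure V` — the structure (Deligne, Hodge II, 2.3.1); `H.gr k : HodgeStructure _ k`
  the pure Hodge structure on `Gr^W_k`; `H.hodgeNumber`; `H.IsGradedPolarizable`
  (every `Gr^W_k` polarizable: Carlson §2(a), Cattani et al. §8.4).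
* `MixedHodgeStructure.isCompl_grF_iff` — the defining condition rewritten inside the lattice of
  `ℂ`-subspaces of `V_ℂ`:
  `((F^p ∩ W_k) + W_{k-1}) ∩ ((conj F^q ∩ W_k) + W_{k-1}) = W_{k-1}` and
  `(F^p ∩ W_k) + (conj F^q ∩ W_k) + W_{k-1} = W_k` (all complexified) for `p + q = k + 1`;
  this is the form in which the axiom is verified for constructions.
* `HodgeStructure.toMixedHodgeStructure` — a pure Hodge structure of weight `n` is an MHS with
  `W_k = 0` for `k < n`, `W_k = V` for `k ≥ n` (Cattani et al., Ex. 3.2.23 (1)).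
* `MixedHodgeStructure.Hom` — morphisms (`ℚ`-linear, `f(W_k) ⊆ W_k`, `f_ℂ(F^p) ⊆ F^p`;
  Deligne 2.3.1, Cattani et al. §3.2.2.2), `Hom.id`, `Hom.comp`, `HodgeStructure.Hom.toMixed`;
  `Hom.IsStrict` and the named fact `Hom.strict` (every morphism of MHS is strict for `W` and
  `F`: Deligne, Hodge II, Thm. 2.3.5 (iii); Cattani et al., Cor. 3.2.21 (i)) — NOT proved here
  (it needs Deligne's splitting `I^{p,q}`, Hodge II §1.2, Cattani et al. Prop. 3.2.19).
* `MixedHodgeStructure.SubMixedHodgeStructure` — a `ℚ`-subspace with the induced filtrations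
  forming an MHS (the subobjects of the abelian category of MHS, Deligne 2.3.5 (i)), and its MHS.

Extensions of MHS, Carlson's Jacobian `J⁰Hom(A, B) = Hom_ℂ / (F⁰Hom_ℂ + Hom_ℚ)` and the
extension class live in `Literature/AlgebraicGeometry/Motives/MixedHodgeExtension.lean`.

## Design notes

* No finite-dimensionality is imposed on `V` (as in `HodgeStructure`); Deligne's `H_ℤ` of finite
  type / Cattani et al.'s `H_A` of finite type corresponds to adding `[Module.Finite ℚ V]` where a
  statement needs it. No integral lattice: this is the `ℚ`-MHS (`A = ℚ`) of Cattani et al. 3.2.15.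
* `grW W k` quotients `W k` by `W (k-1) ∩ W k` (`Submodule.submoduleOf`), so that it is defined for
  an arbitrary family `W`; for the monotone `W` of an MHS this is `W k / W (k-1)`.
* Mathlib has no (mixed) Hodge structures (`rg -i "mixed hodge"` in Mathlib: nothing). We use
  `Submodule.baseChange`, `LinearMap.baseChange`, right exactness `lTensor_mkQ` and flatness of
  `ℂ` over `ℚ` (`Module.Flat.lTensor_preserves_injective_linearMap`).

## References

* [DeligneHodgeII1971] P. Deligne, Théorie de Hodge II, Publ. Math. IHÉS 40 (1971), Déf. 2.3.1,
  Thm. 2.3.5; §1.1 (filtered objects, strictness 1.1.5, induced filtrations); §1.2 (opposed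
  filtrations 1.2.5, Thm. 1.2.10). Not held in the literature store; statements verified in:
* [CattaniElZeinGriffithsLe2014] E. Cattani, F. El Zein, P. Griffiths, Lê D. T. (eds.), Hodge
  Theory, Math. Notes 49, Princeton (2014), Ch. 3 (El Zein–Lê): Def. 3.2.15 (p. 158), §3.2.2.2,
  Thm. 3.2.18, Lemma 3.2.20, Cor. 3.2.21, Ex. 3.2.23 (pp. 161–163); Ch. 8: §8.4 (graded-polarizable).
* [Carlson1980] J. A. Carlson, Extensions of mixed Hodge structures, Journées de géométrie
  algébrique d'Angers 1979, Sijthoff & Noordhoff (1980), 107–127, §2(a).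
-/

open scoped TensorProduct

noncomputable section

namespace Literature.AlgebraicGeometry.Motives

universe u v w

variable {V : Type u} [AddCommGroup V] [Module ℚ V]
variable {V' : Type v} [AddCommGroup V'] [Module ℚ V']

open HodgeStructure (conj complexConj conj_baseChange complexConj_comap_baseChange)

namespace MixedHodgeStructure

/-! ### Base change to `ℂ`: generic lemmas -/

/-- Base change to `ℂ` of an injective `ℚ`-linear map is injective (`ℂ` is flat over `ℚ`).
[folklore] -/
theorem baseChange_injective {U : Type w} [AddCommGroup U] [Module ℚ U] {f : U →ₗ[ℚ] V}
    (hf : Function.Injective f) : Function.Injective (f.baseChange ℂ) := by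
  rw [LinearMap.baseChange_eq_ltensor]
  exact Module.Flat.lTensor_preserves_injective_linearMap f hf

/-- The range of a base-changed map is the base change of the range:
`im (f_ℂ) = (im f)_ℂ` (right exactness of `ℂ ⊗ -`). [folklore] -/
theorem range_baseChange {U : Type w} [AddCommGroup U] [Module ℚ U] (f : U →ₗ[ℚ] V) :
    LinearMap.range (f.baseChange ℂ) = (LinearMap.range f).baseChange ℂ := by
  have hf : f = (LinearMap.range f).subtype ∘ₗ f.rangeRestrict := rfl
  conv_lhs => rw [hf, LinearMap.baseChange_comp]
  rw [LinearMap.range_comp_of_range_eq_top]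
  · rfl
  · exact LinearMap.range_eq_top.2 (LinearMap.baseChange_surjective ℂ f.surjective_rangeRestrict)

/-- The kernel of the base change of a quotient map `U → U/N` is the base change of `N`
(right exactness of `ℂ ⊗ -`, Mathlib's `lTensor_mkQ`). [folklore] -/
theorem ker_mkQ_baseChange {U : Type w} [AddCommGroup U] [Module ℚ U] (N : Submodule ℚ U) :
    LinearMap.ker (N.mkQ.baseChange ℂ) = N.baseChange ℂ := by
  ext x
  exact SetLike.ext_iff.mp (lTensor_mkQ ℂ N) x

/-- Complex conjugation commutes with pushing forward along a base-changed `ℚ`-linear map.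
[folklore] -/
theorem complexConj_map_baseChange {U : Type w} [AddCommGroup U] [Module ℚ U] (f : U →ₗ[ℚ] V)
    (A : Submodule ℂ (ℂ ⊗[ℚ] U)) :
    complexConj (A.map (f.baseChange ℂ)) = (complexConj A).map (f.baseChange ℂ) := by
  ext x
  simp only [HodgeStructure.mem_complexConj, Submodule.mem_map]
  constructor
  · rintro ⟨a, ha, hax⟩
    refine ⟨conj a, by simpa using ha, ?_⟩
    rw [← conj_baseChange, hax, HodgeStructure.conj_conj]
  · rintro ⟨a, ha, rfl⟩
    exact ⟨conj a, ha, by rw [← conj_baseChange]⟩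

/-- A `ℚ`-subspace base-changed to `ℂ` is real: stable under complex conjugation. [folklore] -/
@[simp]
theorem complexConj_baseChange (U : Submodule ℚ V) :
    complexConj (U.baseChange ℂ) = U.baseChange ℂ := by
  change complexConj (LinearMap.range (U.subtype.baseChange ℂ)) = LinearMap.range _
  rw [LinearMap.range_eq_map, complexConj_map_baseChange, HodgeStructure.complexConj_top]

/-! ### Graded pieces of an increasing filtration and the induced Hodge filtration -/

/-- `W_{k-1} ∩ W_k` as a subspace of `W_k` (for a monotone `W`, this is `W_{k-1} ⊆ W_k`).
[folklore] -/
def subPiece (W : ℤ → Submodule ℚ V) (k : ℤ) : Submodule ℚ (W k) :=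
  (W (k - 1)).submoduleOf (W k)

/-- The graded piece `Gr^W_k V = W_k / (W_{k-1} ∩ W_k)` of a family of `ℚ`-subspaces (Deligne,
Hodge II, §1.1 and 2.3.1: `Gr^W_n = W_n / W_{n-1}` for the increasing weight filtration). An
`abbrev`, so that the quotient-module instances are found. [folklore] -/
abbrev grW (W : ℤ → Submodule ℚ V) (k : ℤ) : Type u :=
  ↥(W k) ⧸ subPiece W k

/-- The inclusion `W_{k,ℂ} = ℂ ⊗ W_k → V_ℂ`. [folklore] -/
abbrev grIncl (W : ℤ → Submodule ℚ V) (k : ℤ) : ℂ ⊗[ℚ] ↥(W k) →ₗ[ℂ] ℂ ⊗[ℚ] V :=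
  (W k).subtype.baseChange ℂ

/-- The projection `W_{k,ℂ} = ℂ ⊗ W_k → ℂ ⊗ Gr^W_k`. [folklore] -/
abbrev grProj (W : ℤ → Submodule ℚ V) (k : ℤ) : ℂ ⊗[ℚ] ↥(W k) →ₗ[ℂ] ℂ ⊗[ℚ] grW W k :=
  (subPiece W k).mkQ.baseChange ℂ

/-- The filtration induced by `F` on `ℂ ⊗ Gr^W_k`:
`F^p Gr^W_k := ((F^p ∩ W_{k,ℂ}) + W_{k-1,ℂ}) / W_{k-1,ℂ}` (Deligne, Hodge II, §1.1 and
2.3.1; Cattani et al., Def. 3.2.15, p. 158: "Recall the definition of the induced filtration …"), realised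
as: pull `F^p` back along `W_{k,ℂ} → V_ℂ`, push forward along `W_{k,ℂ} → ℂ ⊗ Gr^W_k`
(using `ℂ ⊗ (W_k / W_{k-1}) = W_{k,ℂ} / W_{k-1,ℂ}`, exactness of `ℂ ⊗ -`).
[cite: CattaniElZeinGriffithsLe2014, Def. 3.2.15] -/
def grF (W : ℤ → Submodule ℚ V) (F : ℤ → Submodule ℂ (ℂ ⊗[ℚ] V)) (k p : ℤ) :
    Submodule ℂ (ℂ ⊗[ℚ] grW W k) :=
  ((F p).comap (grIncl W k)).map (grProj W k)

/-- `grF` is monotone in the filtration. [folklore] -/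
theorem grF_mono {W : ℤ → Submodule ℚ V} {F : ℤ → Submodule ℂ (ℂ ⊗[ℚ] V)} (k : ℤ) {p p' : ℤ}
    (h : F p ≤ F p') : grF W F k p ≤ grF W F k p' :=
  Submodule.map_mono (Submodule.comap_mono h)

/-- `grF` of the whole space is the whole graded piece. [folklore] -/
theorem grF_eq_top_of_eq_top {W : ℤ → Submodule ℚ V} {F : ℤ → Submodule ℂ (ℂ ⊗[ℚ] V)} (k : ℤ)
    {p : ℤ} (h : F p = ⊤) : grF W F k p = ⊤ := by
  rw [grF, h, Submodule.comap_top, Submodule.map_top, LinearMap.range_eq_top]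
  exact LinearMap.baseChange_surjective ℂ (Submodule.mkQ_surjective _)

/-- `grF` of zero is zero. [folklore] -/
theorem grF_eq_bot_of_eq_bot {W : ℤ → Submodule ℚ V} {F : ℤ → Submodule ℂ (ℂ ⊗[ℚ] V)} (k : ℤ)
    {p : ℤ} (h : F p = ⊥) : grF W F k p = ⊥ := by
  rw [grF, h, Submodule.comap_bot, LinearMap.ker_eq_bot.2 (baseChange_injective (W k).injective_subtype),
    Submodule.map_bot]

/-- The injection `W_{k,ℂ} → V_ℂ` is injective (flatness). [folklore] -/
theorem grIncl_injective (W : ℤ → Submodule ℚ V) (k : ℤ) : Function.Injective (grIncl W k) :=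
  baseChange_injective (W k).injective_subtype

/-- The projection `W_{k,ℂ} → ℂ ⊗ Gr^W_k` is surjective. [folklore] -/
theorem grProj_surjective (W : ℤ → Submodule ℚ V) (k : ℤ) : Function.Surjective (grProj W k) :=
  LinearMap.baseChange_surjective ℂ (Submodule.mkQ_surjective _)

/-- The range of `W_{k,ℂ} → V_ℂ` is `W_{k,ℂ} := (W k).baseChange ℂ`. [folklore] -/
theorem range_grIncl (W : ℤ → Submodule ℚ V) (k : ℤ) :
    LinearMap.range (grIncl W k) = (W k).baseChange ℂ := rfl

/-- The kernel of `W_{k,ℂ} → ℂ ⊗ Gr^W_k` is `(W_{k-1} ∩ W_k)_ℂ`. [folklore] -/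
theorem ker_grProj (W : ℤ → Submodule ℚ V) (k : ℤ) :
    LinearMap.ker (grProj W k) = (subPiece W k).baseChange ℂ :=
  ker_mkQ_baseChange _

/-- The kernel of `W_{k,ℂ} → ℂ ⊗ Gr^W_k`, pushed into `V_ℂ`, is `(W_k ∩ W_{k-1})_ℂ`. [folklore] -/
theorem map_grIncl_ker_grProj (W : ℤ → Submodule ℚ V) (k : ℤ) :
    (LinearMap.ker (grProj W k)).map (grIncl W k) = (W k ⊓ W (k - 1)).baseChange ℂ := by
  rw [ker_grProj, Submodule.baseChange, LinearMap.range_eq_map, ← Submodule.map_comp,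
    ← LinearMap.baseChange_comp, ← LinearMap.range_eq_map, range_baseChange, LinearMap.range_comp,
    Submodule.range_subtype, subPiece, Submodule.submoduleOf, Submodule.map_comap_eq,
    Submodule.range_subtype]

/-- Complex conjugation of the induced filtration is induced by the conjugate filtration.
[folklore] -/
theorem complexConj_grF (W : ℤ → Submodule ℚ V) (F : ℤ → Submodule ℂ (ℂ ⊗[ℚ] V)) (k p : ℤ) :
    complexConj (grF W F k p) = grF W (fun i => complexConj (F i)) k p := by
  rw [grF, grF, complexConj_map_baseChange, complexConj_comap_baseChange]

/-- Transport of complementarity along a surjection `π` with kernel `K`: the images of `A` and `B`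
are complementary iff `(A + K) ∩ (B + K) = K` and `A + B + K = ⊤`. [folklore] -/
theorem isCompl_map_iff_of_surjective {R M N : Type*} [Ring R] [AddCommGroup M] [Module R M]
    [AddCommGroup N] [Module R N] (π : M →ₗ[R] N) (hπ : Function.Surjective π)
    (A B : Submodule R M) :
    IsCompl (A.map π) (B.map π) ↔
      (A ⊔ LinearMap.ker π) ⊓ (B ⊔ LinearMap.ker π) = LinearMap.ker π ∧
        A ⊔ B ⊔ LinearMap.ker π = ⊤ := by
  have hinj : Function.Injective (Submodule.comap π) := Submodule.comap_injective_of_surjective hπ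
  rw [isCompl_iff, disjoint_iff, codisjoint_iff, ← Submodule.map_sup]
  constructor
  · rintro ⟨h1, h2⟩
    refine ⟨?_, ?_⟩
    · have := congrArg (Submodule.comap π) h1
      rwa [Submodule.comap_inf, Submodule.comap_map_eq, Submodule.comap_map_eq,
        Submodule.comap_bot] at this
    · have := congrArg (Submodule.comap π) h2
      rwa [Submodule.comap_map_eq, Submodule.comap_top] at this
  · rintro ⟨h1, h2⟩
    refine ⟨hinj ?_, hinj ?_⟩
    · rw [Submodule.comap_inf, Submodule.comap_map_eq, Submodule.comap_map_eq, Submodule.comap_bot,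
        h1]
    · rw [Submodule.comap_map_eq, Submodule.comap_top, h2]

/-- **The MHS axiom inside `V_ℂ`.** For `W`, `F` and integers `k, p, q`: the filtration induced
by `F` on `ℂ ⊗ Gr^W_k` at `p` is complementary to the conjugate of the one induced at `q` iff,
with `W_{k,ℂ} := (W k).baseChange ℂ` and `W'_ℂ := (W k ⊓ W (k-1)).baseChange ℂ`,
`((F^p ∩ W_{k,ℂ}) + W'_ℂ) ∩ ((conj F^q ∩ W_{k,ℂ}) + W'_ℂ) = W'_ℂ` and
`(F^p ∩ W_{k,ℂ}) + (conj F^q ∩ W_{k,ℂ}) + W'_ℂ = W_{k,ℂ}`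
(Cattani et al., Def. 3.2.15 with Prop. 3.2.10: `F^p Gr ⊕ conj F^q Gr = Gr` for `p + q = k + 1`,
`F^p Gr = ((F^p ∩ W_k) + W_{k-1}) / W_{k-1}`). [folklore] -/
theorem isCompl_grF_iff (W : ℤ → Submodule ℚ V) (F : ℤ → Submodule ℂ (ℂ ⊗[ℚ] V)) (k p q : ℤ) :
    IsCompl (grF W F k p) (complexConj (grF W F k q)) ↔
      ((F p ⊓ (W k).baseChange ℂ) ⊔ (W k ⊓ W (k - 1)).baseChange ℂ) ⊓
          ((complexConj (F q) ⊓ (W k).baseChange ℂ) ⊔ (W k ⊓ W (k - 1)).baseChange ℂ) =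
          (W k ⊓ W (k - 1)).baseChange ℂ ∧
        (F p ⊓ (W k).baseChange ℂ) ⊔ (complexConj (F q) ⊓ (W k).baseChange ℂ) ⊔
          (W k ⊓ W (k - 1)).baseChange ℂ = (W k).baseChange ℂ := by
  rw [complexConj_grF, grF, grF, isCompl_map_iff_of_surjective _ (grProj_surjective W k)]
  have hι := grIncl_injective W k
  have hmap : Function.Injective (Submodule.map (grIncl W k)) :=
    Submodule.map_injective_of_injective hι
  rw [← hmap.eq_iff, ← hmap.eq_iff]
  simp only [Submodule.map_inf (grIncl W k) hι, Submodule.map_sup, Submodule.map_comap_eq,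
    map_grIncl_ker_grProj, Submodule.map_top, range_grIncl]
  constructor <;> rintro ⟨h1, h2⟩ <;> refine ⟨?_, ?_⟩
  · simpa only [inf_comm] using h1
  · simpa only [inf_comm] using h2
  · simpa only [inf_comm] using h1
  · simpa only [inf_comm] using h2

/-- For a monotone `W`, `W k ⊓ W (k-1) = W (k-1)`. [folklore] -/
theorem inf_pred_eq_of_monotone {W : ℤ → Submodule ℚ V} (hW : Monotone W) (k : ℤ) :
    W k ⊓ W (k - 1) = W (k - 1) :=
  inf_eq_right.2 (hW (by omega))

end MixedHodgeStructure

/-! ### Mixed Hodge structures -/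

/-- A **mixed `ℚ`-Hodge structure** on the `ℚ`-vector space `V` (Deligne, *Théorie de Hodge II*,
Déf. 2.3.1; Cattani–El Zein–Griffiths–Lê, *Hodge Theory*, Def. 3.2.15 with `A = ℚ`; Carlson 1980,
§2(a)): a finite increasing filtration `W` of `V` (the *weight filtration*), a finite decreasing
filtration `F` of `V_ℂ = ℂ ⊗[ℚ] V` (the *Hodge filtration*), such that for every `k` the filtration
induced by `F` on `ℂ ⊗ Gr^W_k V` (`MixedHodgeStructure.grF`) is `k`-opposed to its complex
conjugate, i.e. defines a pure `ℚ`-Hodge structure of weight `k` on `Gr^W_k V` (`gr`). Finiteness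
of the filtrations is recorded as: some step is `⊥` and some step is `⊤`. No finite-dimensionality
of `V` is imposed (add `[Module.Finite ℚ V]` where needed).
[cite: DeligneHodgeII1971, Déf. 2.3.1] -/
structure MixedHodgeStructure (V : Type u) [AddCommGroup V] [Module ℚ V] where
  /-- The weight filtration `W_k V` (increasing, by `ℚ`-subspaces). -/
  W : ℤ → Submodule ℚ V
  /-- The weight filtration is increasing. -/
  monotone_W : Monotone W
  /-- The weight filtration is finite below: some `W k` is zero. -/
  exists_W_eq_bot : ∃ k, W k = ⊥
  /-- The weight filtration is finite above: some `W k` is everything. -/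
  exists_W_eq_top : ∃ k, W k = ⊤
  /-- The Hodge filtration `F^p V_ℂ` (decreasing, by `ℂ`-subspaces of `ℂ ⊗[ℚ] V`). -/
  F : ℤ → Submodule ℂ (ℂ ⊗[ℚ] V)
  /-- The Hodge filtration is decreasing. -/
  antitone_F : Antitone F
  /-- The Hodge filtration is finite: some `F p` is everything. -/
  exists_F_eq_top : ∃ p, F p = ⊤
  /-- The Hodge filtration is finite: some `F p` is zero. -/
  exists_F_eq_bot : ∃ p, F p = ⊥
  /-- On each `ℂ ⊗ Gr^W_k`, the induced filtration and its conjugate are `k`-opposed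
  (Deligne, Hodge II, 2.3.1 with 1.2.5). -/
  isCompl_grF : ∀ k p q : ℤ, p + q = k + 1 →
    IsCompl (MixedHodgeStructure.grF W F k p)
      (HodgeStructure.complexConj (MixedHodgeStructure.grF W F k q))

namespace MixedHodgeStructure

/-- The **pure Hodge structure of weight `k` on `Gr^W_k V`** induced by a mixed Hodge structure
(Deligne, Hodge II, 2.3.1; Cattani et al., Def. 3.2.15). [cite: DeligneHodgeII1971, Déf. 2.3.1] -/
def gr (H : MixedHodgeStructure V) (k : ℤ) : HodgeStructure (grW H.W k) k where
  F := grF H.W H.F k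
  antitone_F _ _ h := grF_mono k (H.antitone_F h)
  exists_F_eq_top := by
    obtain ⟨p, hp⟩ := H.exists_F_eq_top
    exact ⟨p, grF_eq_top_of_eq_top k hp⟩
  exists_F_eq_bot := by
    obtain ⟨p, hp⟩ := H.exists_F_eq_bot
    exact ⟨p, grF_eq_bot_of_eq_bot k hp⟩
  isCompl_F_complexConj := H.isCompl_grF k

/-- The Hodge filtration of `H.gr k` is the induced filtration `grF`. [folklore] -/
@[simp]
theorem gr_F (H : MixedHodgeStructure V) (k p : ℤ) : (H.gr k).F p = grF H.W H.F k p := rfl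

/-- The MHS axiom of `H` in the lattice form of `isCompl_grF_iff`, with `W k ⊓ W (k-1)`
simplified to `W (k-1)`. [folklore] -/
theorem grOpposed (H : MixedHodgeStructure V) (k p q : ℤ) (hpq : p + q = k + 1) :
    ((H.F p ⊓ (H.W k).baseChange ℂ) ⊔ (H.W (k - 1)).baseChange ℂ) ⊓
        ((complexConj (H.F q) ⊓ (H.W k).baseChange ℂ) ⊔ (H.W (k - 1)).baseChange ℂ) =
        (H.W (k - 1)).baseChange ℂ ∧
      (H.F p ⊓ (H.W k).baseChange ℂ) ⊔ (complexConj (H.F q) ⊓ (H.W k).baseChange ℂ) ⊔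
        (H.W (k - 1)).baseChange ℂ = (H.W k).baseChange ℂ := by
  have h := (isCompl_grF_iff H.W H.F k p q).1 (H.isCompl_grF k p q hpq)
  rwa [inf_pred_eq_of_monotone H.monotone_W] at h

/-- The **Hodge numbers** of a mixed Hodge structure: `h^{p,q}(H) := h^{p,q}(Gr^W_{p+q} H)`
(Deligne, Hodge II, §2.3; Cattani et al., §3.2.2.6, p. 162). [cite: CattaniElZeinGriffithsLe2014, §3.2.2.6] -/
def hodgeNumber (H : MixedHodgeStructure V) (p q : ℤ) : ℕ :=
  (H.gr (p + q)).hodgeNumber p q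

/-- A mixed Hodge structure is **graded-polarizable** if every `Gr^W_k` admits a polarization
(Carlson 1980, §2(a): "a polarization of `H` is a set of bilinear forms which polarize the graded
pieces individually"; Cattani et al., §8.4). [cite: Carlson1980, §2(a)] -/
def IsGradedPolarizable (H : MixedHodgeStructure V) : Prop :=
  ∀ k, (H.gr k).IsPolarizable

/-- The weights of `H`: `k` is a weight if `Gr^W_k ≠ 0`, i.e. `W (k-1) < W k`. [folklore] -/
def IsWeight (H : MixedHodgeStructure V) (k : ℤ) : Prop :=
  H.W (k - 1) < H.W k

/-- `H` is **pure of weight `n`** (as an MHS) if `W_k = 0` for `k < n` and `W_k = V` for `k ≥ n`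
(Cattani et al., Ex. 3.2.23 (1)). [cite: CattaniElZeinGriffithsLe2014, Ex. 3.2.23 (1)] -/
def IsPure (H : MixedHodgeStructure V) (n : ℤ) : Prop :=
  (∀ k < n, H.W k = ⊥) ∧ ∀ k, n ≤ k → H.W k = ⊤

end MixedHodgeStructure

/-! ### Pure Hodge structures as mixed Hodge structures -/

namespace HodgeStructure

variable {n : ℤ}

/-- The trivial weight filtration of a pure Hodge structure of weight `n`: `0` below `n`, `V` from
`n` on. [folklore] -/
def trivialWeightFiltration (V : Type u) [AddCommGroup V] [Module ℚ V] (n k : ℤ) :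
    Submodule ℚ V :=
  if k < n then ⊥ else ⊤

/-- Below `n` the trivial weight filtration is `0`. [folklore] -/
theorem trivialWeightFiltration_of_lt {k : ℤ} (h : k < n) : trivialWeightFiltration V n k = ⊥ :=
  if_pos h

/-- From `n` on the trivial weight filtration is everything. [folklore] -/
theorem trivialWeightFiltration_of_le {k : ℤ} (h : n ≤ k) : trivialWeightFiltration V n k = ⊤ :=
  if_neg (not_lt.2 h)

/-- The trivial weight filtration is increasing. [folklore] -/
theorem monotone_trivialWeightFiltration (n : ℤ) : Monotone (trivialWeightFiltration V n) := by
  intro k l hkl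
  by_cases hk : k < n
  · rw [trivialWeightFiltration_of_lt hk]
    exact bot_le
  · rw [trivialWeightFiltration_of_le (le_trans (not_lt.1 hk) hkl)]
    exact le_top

/-- **A pure Hodge structure of weight `n` is a mixed Hodge structure** with the trivial weight
filtration `W_k = 0` (`k < n`), `W_k = V` (`k ≥ n`) and the same Hodge filtration
(Cattani et al., Ex. 3.2.23 (1), p. 162). The only non-trivial graded piece is
`Gr^W_n = V`, where the axiom is the `n`-opposedness of `F`.
[cite: CattaniElZeinGriffithsLe2014, Ex. 3.2.23 (1)] -/
def toMixedHodgeStructure (H : HodgeStructure V n) : MixedHodgeStructure V where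
  W := trivialWeightFiltration V n
  monotone_W := monotone_trivialWeightFiltration n
  exists_W_eq_bot := ⟨n - 1, trivialWeightFiltration_of_lt (by omega)⟩
  exists_W_eq_top := ⟨n, trivialWeightFiltration_of_le le_rfl⟩
  F := H.F
  antitone_F := H.antitone_F
  exists_F_eq_top := H.exists_F_eq_top
  exists_F_eq_bot := H.exists_F_eq_bot
  isCompl_grF k p q hpq := by
    rw [MixedHodgeStructure.isCompl_grF_iff,
      MixedHodgeStructure.inf_pred_eq_of_monotone (monotone_trivialWeightFiltration n)]
    rcases lt_trichotomy k n with hk | rfl | hk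
    · simp [trivialWeightFiltration_of_lt hk, trivialWeightFiltration_of_lt (show k - 1 < n by omega)]
    · obtain ⟨h1, h2⟩ := H.isCompl_F_complexConj p q hpq
      rw [disjoint_iff] at h1
      rw [codisjoint_iff] at h2
      simp [trivialWeightFiltration_of_le (le_refl k),
        trivialWeightFiltration_of_lt (show k - 1 < k by omega), h1, h2]
    · simp [trivialWeightFiltration_of_le hk.le, trivialWeightFiltration_of_le (show n ≤ k - 1 by omega)]

/-- The weight filtration of a pure Hodge structure regarded as an MHS. [folklore] -/
@[simp]
theorem toMixedHodgeStructure_W (H : HodgeStructure V n) (k : ℤ) :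
    H.toMixedHodgeStructure.W k = trivialWeightFiltration V n k := rfl

/-- The Hodge filtration of a pure Hodge structure regarded as an MHS is unchanged. [folklore] -/
@[simp]
theorem toMixedHodgeStructure_F (H : HodgeStructure V n) (p : ℤ) :
    H.toMixedHodgeStructure.F p = H.F p := rfl

/-- A pure Hodge structure of weight `n`, regarded as an MHS, is pure of weight `n`. [folklore] -/
theorem isPure_toMixedHodgeStructure (H : HodgeStructure V n) :
    H.toMixedHodgeStructure.IsPure n :=
  ⟨fun _ hk => trivialWeightFiltration_of_lt hk, fun _ hk => trivialWeightFiltration_of_le hk⟩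

end HodgeStructure

/-! ### Morphisms -/

namespace MixedHodgeStructure

/-- A **morphism of mixed Hodge structures**: a `ℚ`-linear map compatible with the weight
filtrations, whose complexification is compatible with the Hodge filtrations (Deligne, Hodge II,
2.3.1; Cattani et al., §3.2.2.2, p. 158; Carlson 1980, §2(a), morphisms of weight `0`).
[cite: DeligneHodgeII1971, 2.3.1] -/
@[ext]
structure Hom (H₁ : MixedHodgeStructure V) (H₂ : MixedHodgeStructure V') where
  /-- The underlying `ℚ`-linear map. -/
  toLinearMap : V →ₗ[ℚ] V'
  /-- `f(W_k) ⊆ W_k`. -/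
  map_W_le : ∀ k, (H₁.W k).map toLinearMap ≤ H₂.W k
  /-- `f_ℂ(F^p) ⊆ F^p`. -/
  map_F_le : ∀ p, (H₁.F p).map (toLinearMap.baseChange ℂ) ≤ H₂.F p

namespace Hom

/-- The identity morphism. [folklore] -/
protected def id (H : MixedHodgeStructure V) : Hom H H where
  toLinearMap := LinearMap.id
  map_W_le k := by simp
  map_F_le p := by simp [LinearMap.baseChange_id]

/-- The identity morphism is the identity map. [folklore] -/
@[simp]
theorem id_toLinearMap (H : MixedHodgeStructure V) : (Hom.id H).toLinearMap = LinearMap.id := rfl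

/-- Composition of morphisms of mixed Hodge structures. [folklore] -/
def comp {U : Type w} [AddCommGroup U] [Module ℚ U] {H₁ : MixedHodgeStructure V}
    {H₂ : MixedHodgeStructure V'} {H₃ : MixedHodgeStructure U} (g : Hom H₂ H₃) (f : Hom H₁ H₂) :
    Hom H₁ H₃ where
  toLinearMap := g.toLinearMap ∘ₗ f.toLinearMap
  map_W_le k := by
    rw [Submodule.map_comp]
    exact (Submodule.map_mono (f.map_W_le k)).trans (g.map_W_le k)
  map_F_le p := by
    rw [LinearMap.baseChange_comp, Submodule.map_comp]
    exact (Submodule.map_mono (f.map_F_le p)).trans (g.map_F_le p)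

/-- The underlying map of a composite. [folklore] -/
@[simp]
theorem comp_toLinearMap {U : Type w} [AddCommGroup U] [Module ℚ U] {H₁ : MixedHodgeStructure V}
    {H₂ : MixedHodgeStructure V'} {H₃ : MixedHodgeStructure U} (g : Hom H₂ H₃) (f : Hom H₁ H₂) :
    (g.comp f).toLinearMap = g.toLinearMap ∘ₗ f.toLinearMap := rfl

/-- The zero morphism. [folklore] -/
protected def zero (H₁ : MixedHodgeStructure V) (H₂ : MixedHodgeStructure V') : Hom H₁ H₂ where
  toLinearMap := 0
  map_W_le k := by simp
  map_F_le p := by simp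

/-- A morphism also maps `conj F^q` into `conj F^q` (its complexification commutes with `conj`;
Cattani et al., §3.2.2.2: "which implies that it is also compatible with `conj F`"). [folklore] -/
theorem map_complexConj_F_le {H₁ : MixedHodgeStructure V} {H₂ : MixedHodgeStructure V'}
    (f : Hom H₁ H₂) (q : ℤ) :
    (complexConj (H₁.F q)).map (f.toLinearMap.baseChange ℂ) ≤ complexConj (H₂.F q) := by
  rw [← complexConj_map_baseChange]
  exact HodgeStructure.complexConj_mono (f.map_F_le q)

/-- The complexification of a morphism maps `W_{k,ℂ}` into `W_{k,ℂ}`. [folklore] -/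
theorem map_baseChange_W_le {H₁ : MixedHodgeStructure V} {H₂ : MixedHodgeStructure V'}
    (f : Hom H₁ H₂) (k : ℤ) :
    ((H₁.W k).baseChange ℂ).map (f.toLinearMap.baseChange ℂ) ≤ (H₂.W k).baseChange ℂ := by
  rw [Submodule.baseChange, LinearMap.range_eq_map, ← Submodule.map_comp, ← LinearMap.baseChange_comp,
    ← LinearMap.range_eq_map, range_baseChange, LinearMap.range_comp, Submodule.range_subtype]
  exact Submodule.baseChange_mono ℂ (f.map_W_le k)

/-- A morphism of MHS is **strict** if it is strictly compatible with both filtrations: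
`f(W_k V) = W_k V' ∩ im f` and `f_ℂ(F^p V_ℂ) = F^p V'_ℂ ∩ im f_ℂ` (Deligne, Hodge II, 1.1.5).
Every morphism is strict (Deligne, Hodge II, Thm. 2.3.5 (iii)): see the named fact `Hom.strict`.
[cite: DeligneHodgeII1971, 1.1.5] -/
structure IsStrict {H₁ : MixedHodgeStructure V} {H₂ : MixedHodgeStructure V'} (f : Hom H₁ H₂) :
    Prop where
  /-- Strictness for the weight filtration (over `ℚ`). -/
  map_W : ∀ k, (H₁.W k).map f.toLinearMap = H₂.W k ⊓ LinearMap.range f.toLinearMap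
  /-- Strictness for the Hodge filtration. -/
  map_F : ∀ p, (H₁.F p).map (f.toLinearMap.baseChange ℂ) =
    H₂.F p ⊓ LinearMap.range (f.toLinearMap.baseChange ℂ)

/-- **Morphisms of mixed Hodge structures are strict** for the weight filtration and for the
Hodge filtration (Deligne, *Théorie de Hodge II*, Thm. 2.3.5 (iii); Cattani–El Zein–Griffiths–Lê,
Cor. 3.2.21 (i); the proof uses Deligne's functorial splitting
`I^{p,q} = (F^p ∩ W_{p+q}) ∩ (conj F^q ∩ W_{p+q} + Σ_{i ≥ 1} conj F^{q-i} ∩ W_{p+q-1-i})`,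
Hodge II §1.2 (Thm. 1.2.10), Cattani et al. Prop. 3.2.19, pp. 159–161). Named fact, not proved
in this file.
[cite: DeligneHodgeII1971, Thm. 2.3.5 (iii)] -/
def strict : Prop :=
  ∀ {H₁ : MixedHodgeStructure V} {H₂ : MixedHodgeStructure V'} (f : Hom H₁ H₂), f.IsStrict

end Hom

end MixedHodgeStructure

/-- A morphism of pure Hodge structures of the same weight is a morphism of the associated mixed
Hodge structures (Cattani et al., Ex. 3.2.23 (1); the category of pure Hodge structures of weight
`n` is a full subcategory of MHS). [folklore] -/
def HodgeStructure.Hom.toMixed {n : ℤ} {H₁ : HodgeStructure V n} {H₂ : HodgeStructure V' n}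
    (f : HodgeStructure.Hom H₁ H₂) :
    MixedHodgeStructure.Hom H₁.toMixedHodgeStructure H₂.toMixedHodgeStructure where
  toLinearMap := f.toLinearMap
  map_W_le k := by
    by_cases hk : k < n
    · simp [HodgeStructure.trivialWeightFiltration_of_lt hk]
    · simp [HodgeStructure.trivialWeightFiltration_of_le (not_lt.1 hk)]
  map_F_le := f.map_F_le

/-- The underlying map of `f.toMixed` is that of `f`. [folklore] -/
@[simp]
theorem HodgeStructure.Hom.toMixed_toLinearMap {n : ℤ} {H₁ : HodgeStructure V n}
    {H₂ : HodgeStructure V' n} (f : HodgeStructure.Hom H₁ H₂) :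
    f.toMixed.toLinearMap = f.toLinearMap := rfl

/-! ### Sub-mixed Hodge structures -/

namespace MixedHodgeStructure

/-- The weight filtration induced on a `ℚ`-subspace `U`: `W_k ∩ U`. [folklore] -/
def inducedW (H : MixedHodgeStructure V) (U : Submodule ℚ V) (k : ℤ) : Submodule ℚ U :=
  (H.W k).submoduleOf U

/-- The Hodge filtration induced on `U_ℂ`: the pull-back of `F^p` along `U_ℂ → V_ℂ`. [folklore] -/
def inducedF (H : MixedHodgeStructure V) (U : Submodule ℚ V) (p : ℤ) : Submodule ℂ (ℂ ⊗[ℚ] U) :=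
  (H.F p).comap (U.subtype.baseChange ℂ)

/-- A **sub-mixed Hodge structure** of `H`: a `ℚ`-subspace `U ⊆ V` such that the filtrations
induced by `W` on `U` and by `F` on `U_ℂ` form a mixed Hodge structure (these are exactly the
subobjects of `H` in the abelian category of MHS: Deligne, Hodge II, Thm. 2.3.5 (i)–(ii);
Cattani et al., Lemma 3.2.20 — kernels carry the induced filtrations). As for
`HodgeStructure.SubHodgeStructure`, the opposedness on the graded pieces is part of the data.
[cite: DeligneHodgeII1971, Thm. 2.3.5] -/
structure SubMixedHodgeStructure (H : MixedHodgeStructure V) where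
  /-- The underlying `ℚ`-subspace. -/
  toSubmodule : Submodule ℚ V
  /-- The induced filtrations satisfy the MHS axiom on each graded piece. -/
  isCompl_grF : ∀ k p q : ℤ, p + q = k + 1 →
    IsCompl (grF (H.inducedW toSubmodule) (H.inducedF toSubmodule) k p)
      (complexConj (grF (H.inducedW toSubmodule) (H.inducedF toSubmodule) k q))

namespace SubMixedHodgeStructure

variable {H : MixedHodgeStructure V}

/-- The mixed Hodge structure on (the underlying space of) a sub-MHS, with the induced
filtrations (Deligne, Hodge II, 2.3.5 (ii)). [folklore] -/
def toMixedHodgeStructure (S : SubMixedHodgeStructure H) : MixedHodgeStructure S.toSubmodule where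
  W := H.inducedW S.toSubmodule
  monotone_W _ _ h := Submodule.comap_mono (H.monotone_W h)
  exists_W_eq_bot := by
    obtain ⟨k, hk⟩ := H.exists_W_eq_bot
    refine ⟨k, ?_⟩
    rw [inducedW, Submodule.submoduleOf, hk, Submodule.comap_bot, Submodule.ker_subtype]
  exists_W_eq_top := by
    obtain ⟨k, hk⟩ := H.exists_W_eq_top
    exact ⟨k, by rw [inducedW, Submodule.submoduleOf, hk, Submodule.comap_top]⟩
  F := H.inducedF S.toSubmodule
  antitone_F _ _ h := Submodule.comap_mono (H.antitone_F h)
  exists_F_eq_top := by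
    obtain ⟨p, hp⟩ := H.exists_F_eq_top
    exact ⟨p, by rw [inducedF, hp, Submodule.comap_top]⟩
  exists_F_eq_bot := by
    obtain ⟨p, hp⟩ := H.exists_F_eq_bot
    refine ⟨p, ?_⟩
    rw [inducedF, hp, Submodule.comap_bot]
    exact LinearMap.ker_eq_bot.2 (baseChange_injective S.toSubmodule.injective_subtype)
  isCompl_grF := S.isCompl_grF

/-- The inclusion of a sub-MHS is a morphism of mixed Hodge structures. [folklore] -/
def subtype (S : SubMixedHodgeStructure H) : Hom S.toMixedHodgeStructure H where
  toLinearMap := S.toSubmodule.subtype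
  map_W_le _ := Submodule.map_comap_le _ _
  map_F_le _ := Submodule.map_comap_le _ _

end SubMixedHodgeStructure

/-! ### Quotient mixed Hodge structures -/

/-- The weight filtration induced on a quotient `V / U`: the image of `W_k`. [folklore] -/
def quotW (H : MixedHodgeStructure V) (U : Submodule ℚ V) (k : ℤ) : Submodule ℚ (V ⧸ U) :=
  (H.W k).map U.mkQ

/-- The Hodge filtration induced on `(V / U)_ℂ`: the image of `F^p` along `V_ℂ → (V/U)_ℂ`.
[folklore] -/
def quotF (H : MixedHodgeStructure V) (U : Submodule ℚ V) (p : ℤ) : Submodule ℂ (ℂ ⊗[ℚ] (V ⧸ U)) :=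
  (H.F p).map (U.mkQ.baseChange ℂ)

/-- The quotient filtrations of `H` by the `ℚ`-subspace `U` form a mixed Hodge structure on
`V / U`. By Deligne, Hodge II, Thm. 2.3.5 (i)–(ii) (Cattani et al., Lemma 3.2.20: cokernels carry
the quotient filtrations) this holds whenever `U` underlies a sub-MHS; that implication needs the
splitting `I^{p,q}` and is not proved here, so the condition is a hypothesis of `quotient`.
[cite: DeligneHodgeII1971, Thm. 2.3.5] -/
def IsQuotientMHS (H : MixedHodgeStructure V) (U : Submodule ℚ V) : Prop :=
  ∀ k p q : ℤ, p + q = k + 1 →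
    IsCompl (grF (H.quotW U) (H.quotF U) k p) (complexConj (grF (H.quotW U) (H.quotF U) k q))

/-- The **quotient mixed Hodge structure** on `V / U` with the quotient filtrations, given that
they satisfy the MHS axiom (`IsQuotientMHS`; automatic for `U` a sub-MHS by Deligne 2.3.5 (ii)).
[folklore] -/
def quotient (H : MixedHodgeStructure V) (U : Submodule ℚ V) (h : H.IsQuotientMHS U) :
    MixedHodgeStructure (V ⧸ U) where
  W := H.quotW U
  monotone_W _ _ hkl := Submodule.map_mono (H.monotone_W hkl)
  exists_W_eq_bot := by
    obtain ⟨k, hk⟩ := H.exists_W_eq_bot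
    exact ⟨k, by rw [quotW, hk, Submodule.map_bot]⟩
  exists_W_eq_top := by
    obtain ⟨k, hk⟩ := H.exists_W_eq_top
    exact ⟨k, by rw [quotW, hk, Submodule.map_top, Submodule.range_mkQ]⟩
  F := H.quotF U
  antitone_F _ _ h := Submodule.map_mono (H.antitone_F h)
  exists_F_eq_top := by
    obtain ⟨p, hp⟩ := H.exists_F_eq_top
    refine ⟨p, ?_⟩
    rw [quotF, hp, Submodule.map_top, LinearMap.range_eq_top]
    exact LinearMap.baseChange_surjective ℂ (Submodule.mkQ_surjective U)
  exists_F_eq_bot := by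
    obtain ⟨p, hp⟩ := H.exists_F_eq_bot
    exact ⟨p, by rw [quotF, hp, Submodule.map_bot]⟩
  isCompl_grF := h

/-- The quotient map `V → V / U` is a morphism of mixed Hodge structures. [folklore] -/
def mkQ (H : MixedHodgeStructure V) (U : Submodule ℚ V) (h : H.IsQuotientMHS U) :
    Hom H (H.quotient U h) where
  toLinearMap := U.mkQ
  map_W_le _ := le_rfl
  map_F_le _ := le_rfl

/-! ### Functoriality of the graded pieces -/

namespace Hom

variable {H₁ : MixedHodgeStructure V} {H₂ : MixedHodgeStructure V'}

/-- The restriction `W_k V → W_k V'` of a morphism. [folklore] -/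
def restrictW (f : Hom H₁ H₂) (k : ℤ) : H₁.W k →ₗ[ℚ] H₂.W k :=
  f.toLinearMap.restrict fun x hx => f.map_W_le k ⟨x, hx, rfl⟩

/-- `restrictW` is `f` on underlying vectors. [folklore] -/
@[simp]
theorem coe_restrictW (f : Hom H₁ H₂) (k : ℤ) (x : H₁.W k) : (f.restrictW k x : V') = f.toLinearMap x :=
  rfl

/-- The map `Gr^W_k(f) : Gr^W_k V → Gr^W_k V'` induced by a morphism (Deligne, Hodge II, §1.1 and
Thm. 2.3.5 (iii)). [folklore] -/
def grMap (f : Hom H₁ H₂) (k : ℤ) : grW H₁.W k →ₗ[ℚ] grW H₂.W k :=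
  Submodule.mapQ (subPiece H₁.W k) (subPiece H₂.W k) (f.restrictW k) fun x hx =>
    f.map_W_le (k - 1) ⟨x, hx, rfl⟩

/-- `Gr^W_k(f)` on the class of `x ∈ W_k` is the class of `f x`. [folklore] -/
@[simp]
theorem grMap_mk (f : Hom H₁ H₂) (k : ℤ) (x : H₁.W k) :
    f.grMap k (Submodule.Quotient.mk x) = Submodule.Quotient.mk (f.restrictW k x) :=
  rfl

/-- Compatibility of `Gr^W_k(f)_ℂ` with the projections `W_{k,ℂ} → ℂ ⊗ Gr^W_k`. [folklore] -/
theorem grMap_baseChange_comp_grProj (f : Hom H₁ H₂) (k : ℤ) :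
    (f.grMap k).baseChange ℂ ∘ₗ grProj H₁.W k = grProj H₂.W k ∘ₗ (f.restrictW k).baseChange ℂ := by
  rw [grProj, grProj, ← LinearMap.baseChange_comp, ← LinearMap.baseChange_comp, grMap,
    Submodule.mapQ_mkQ]

/-- Compatibility of `(f|W_k)_ℂ` with the inclusions `W_{k,ℂ} → V_ℂ`. [folklore] -/
theorem grIncl_comp_restrictW_baseChange (f : Hom H₁ H₂) (k : ℤ) :
    grIncl H₂.W k ∘ₗ (f.restrictW k).baseChange ℂ = f.toLinearMap.baseChange ℂ ∘ₗ grIncl H₁.W k := by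
  rw [grIncl, grIncl, ← LinearMap.baseChange_comp, ← LinearMap.baseChange_comp]
  rfl

/-- **`Gr^W_k` is a functor to pure Hodge structures of weight `k`**: the map induced by a
morphism of MHS on `Gr^W_k` is a morphism of the pure Hodge structures `H₁.gr k → H₂.gr k`
(Deligne, Hodge II, 2.3.5 (iii)–(iv); Cattani et al., Cor. 3.2.21). [cite: DeligneHodgeII1971, Thm. 2.3.5] -/
def gr (f : Hom H₁ H₂) (k : ℤ) : HodgeStructure.Hom (H₁.gr k) (H₂.gr k) where
  toLinearMap := f.grMap k
  map_F_le p := by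
    rintro _ ⟨y, hy, rfl⟩
    rw [MixedHodgeStructure.gr_F, grF] at hy
    obtain ⟨a, ha, rfl⟩ := hy
    rw [MixedHodgeStructure.gr_F, grF]
    refine ⟨(f.restrictW k).baseChange ℂ a, ?_, ?_⟩
    · have ha' : grIncl H₁.W k a ∈ H₁.F p := ha
      show grIncl H₂.W k ((f.restrictW k).baseChange ℂ a) ∈ H₂.F p
      rw [← LinearMap.comp_apply, grIncl_comp_restrictW_baseChange, LinearMap.comp_apply]
      exact f.map_F_le p ⟨_, ha', rfl⟩
    · rw [← LinearMap.comp_apply, ← grMap_baseChange_comp_grProj, LinearMap.comp_apply]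

/-- The underlying map of `f.gr k` is `Gr^W_k(f)`. [folklore] -/
@[simp]
theorem gr_toLinearMap (f : Hom H₁ H₂) (k : ℤ) : (f.gr k).toLinearMap = f.grMap k := rfl

end Hom

/-! ### Sanity checks -/

/-- The identity morphism is strict. -/
example (H : MixedHodgeStructure V) : (Hom.id H).IsStrict where
  map_W k := by simp
  map_F p := by simp [LinearMap.baseChange_id]

/-- The Tate structure `ℚ(j)`, a pure Hodge structure of weight `-2j`, is a mixed Hodge structure,
pure of weight `-2j`. -/
example (j : ℤ) : (HodgeStructure.tate j).toMixedHodgeStructure.IsPure (-2 * j) :=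
  HodgeStructure.isPure_toMixedHodgeStructure _

/-- Its weight filtration jumps exactly at `-2j`: `W_{-2j-1} = 0`, `W_{-2j} = ℚ`. -/
example (j : ℤ) : (HodgeStructure.tate j).toMixedHodgeStructure.W (-2 * j - 1) = ⊥ ∧
    (HodgeStructure.tate j).toMixedHodgeStructure.W (-2 * j) = ⊤ :=
  ⟨HodgeStructure.trivialWeightFiltration_of_lt (by omega),
    HodgeStructure.trivialWeightFiltration_of_le le_rfl⟩

end MixedHodgeStructure

end Literature.AlgebraicGeometry.Motives

end
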